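import Summits.Parity.GeneralizedHardyLittlewood.Theorems.BeyondDiagonalBeatsQuarter.PeterssonSplitAFE
import Literature.NumberTheory.LFunctions.KMVCutoffWSmooth
import Literature.NumberTheory.LFunctions.KowalskiMichelPeterssonFormula
import Literature.Analysis.FunctionSpaces.BesselJAnalyticProofs
import Mathlib.Analysis.SpecialFunctions.Sqrt
import Mathlib.Analysis.SpecialFunctions.Pow.Deriv
import HarnessLib

/-!
# Route `PrimeLevelFamEdge`, crux K_B (stmt-Parity-20343), line `diagonal_kernel_split` rev 4,
# plan Ω, sub-line **Ω-d4 (weights) — the real-variable factor of a Kloosterman layer of `offDiag` is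
# smooth on the open quadrant, and the summand FACTORISES as (smooth weight) × S(αk₁, βk₂; qr)**

In `PeterssonSplit.offDiag q l m`, after `nᵢ = dᵢkᵢ` (`dᵢ ∣ l, m`) and opening
`petJ = (2π/q) Σ_r petKloostermanTerm`, the `(k₁,k₂)`-summand of the layer `(d₁,d₂,r)` is
`w_q(d₁k₁,d₂k₂) · r⁻¹ S(αk₁, βk₂; qr) J₁(4π√(αk₁·βk₂)/(qr))`, `α = l/d₁`, `β = m/d₂`
(`w_q = PeterssonSplit.afeWeight`, `W = KMV2000.cutoffW`). For Poisson summation (Ω-d1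
`OffDiagPoissonTwisted`, Ω-d4 `OffDiagDyadic`) one needs (i) the factorisation
«summand = g(k₁,k₂) · S(αk₁, βk₂; qr)» with `g` a function of REAL variables, and (ii) `g ∈ C^∞` on the
open quadrant `(0,∞)²`. Here:

* `contDiffOn_afeWeightR` — `y ↦ ((d₁y₁)(d₂y₂))^{−1/2}·W((d₁y₁)(d₂y₂)/q̂²)` is `C^∞` on `(0,∞)²`
  (`KMV2000.contDiffAt_cutoffW`, p636169, + `Real.contDiffAt_rpow_const_of_ne`);
* `contDiffOn_besselJ_one_sqrt` — `y ↦ J₁(4π√(αy₁·βy₂)/c)` is `C^∞` on `(0,∞)²` (`contDiff_besselJ_holds`,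
  `Real.contDiffAt_sqrt`);
* **`contDiffOn_layerWeight`** — the full weight
  `g(y) = ((d₁y₁)(d₂y₂))^{−1/2} W((d₁y₁)(d₂y₂)/q̂²) · r⁻¹ · J₁(4π√(αy₁·βy₂)/(qr))`, cast to `ℂ`, is `C^∞` on
  `(0,∞)²` — so `θ(y₁/K₁)θ(y₂/K₂)·g` is a legitimate Poisson datum (`OffDiag.contDiff_dyadicBox_mul`);
* **`afeWeight_mul_petKloostermanTerm_eq`** — the factorisation at integer points:
  `w_q(d₁k₁,d₂k₂)·petKloostermanTerm q (αk₁) (βk₂) r = g(k₁,k₂) · S(α·k₁, β·k₂; qr)` (`r ≥ 1`), with the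
  Kloosterman arguments in the product shape `(α : ZMod (qr))·k₁` of `OffDiag.sum_sum_kloostermanSum_mul_stdAddChar`.

Theorems only (the weight is written inline, no definition); standard axioms. Helper toward
`stub_offDiagBelowSlack_io`; closes nothing. «The programme SEARCHES and TYPES; no claim about Landau–Siegel
zeros, Theorems 1–2 of arXiv:2211.02515 or a repaired Margin232 until a kernel theorem says so.»
-/

noncomputable section

open Set
open scoped Real ContDiff

namespace Summit.Parity.GeneralizedHardyLittlewood.Theorems.BeyondDiagonalBeatsQuarter.OffDiag

open Literature.NumberTheory.LFunctions Literature.NumberTheory.LFunctions.KMV2000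
open Literature.Analysis.FunctionSpaces (besselJ contDiff_besselJ_holds)
open PeterssonSplit (afeWeight)

/-! ### Smoothness on the open quadrant -/

/-- On the open quadrant, `(d₁y₁)(d₂y₂) > 0` for `d₁, d₂ > 0`. [folklore] -/
theorem dilatedProd_pos {d₁ d₂ : ℝ} (hd₁ : 0 < d₁) (hd₂ : 0 < d₂) {y : ℝ × ℝ}
    (hy : y ∈ Ioi (0 : ℝ) ×ˢ Ioi (0 : ℝ)) : 0 < d₁ * y.1 * (d₂ * y.2) := by
  obtain ⟨h1, h2⟩ := hy
  exact mul_pos (mul_pos hd₁ h1) (mul_pos hd₂ h2)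

/-- The map `y ↦ (d₁y₁)(d₂y₂)` is smooth. [folklore] -/
theorem contDiff_dilatedProd (d₁ d₂ : ℝ) :
    ContDiff ℝ ∞ (fun y : ℝ × ℝ ↦ d₁ * y.1 * (d₂ * y.2)) :=
  (contDiff_const.mul contDiff_fst).mul (contDiff_const.mul contDiff_snd)

/-- **The AFE weight in real variables is smooth on the open quadrant**:
`y ↦ ((d₁y₁)(d₂y₂))^{−1/2} · W((d₁y₁)(d₂y₂)/q̂²)` is `C^∞` on `(0,∞)²` for `d₁, d₂, q̂ > 0`
(`W = KMV2000.cutoffW` is `C^∞` on `(0,∞)`: `KMV2000.contDiffAt_cutoffW`).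
[cite: KowalskiMichelVanderKam2000, (21)–(22) p. 12 — derivation] -/
theorem contDiffOn_afeWeightR {d₁ d₂ Q : ℝ} (hd₁ : 0 < d₁) (hd₂ : 0 < d₂) (hQ : 0 < Q) :
    ContDiffOn ℝ ∞ (fun y : ℝ × ℝ ↦
      (d₁ * y.1 * (d₂ * y.2)) ^ (-(1 / 2 : ℝ)) * cutoffW (d₁ * y.1 * (d₂ * y.2) / Q ^ 2))
      (Ioi (0 : ℝ) ×ˢ Ioi (0 : ℝ)) := by
  intro y hy
  have hpos := dilatedProd_pos hd₁ hd₂ hy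
  have hP : ContDiffAt ℝ ∞ (fun y : ℝ × ℝ ↦ d₁ * y.1 * (d₂ * y.2)) y := (contDiff_dilatedProd d₁ d₂).contDiffAt
  have h1 : ContDiffAt ℝ ∞ (fun y : ℝ × ℝ ↦ (d₁ * y.1 * (d₂ * y.2)) ^ (-(1 / 2 : ℝ))) y :=
    hP.rpow_const_of_ne hpos.ne'
  have h2 := (contDiffAt_cutoffW (div_pos hpos (pow_pos hQ 2))).comp y (hP.div_const (Q ^ 2))
  exact (h1.mul h2).contDiffWithinAt

/-- **The Bessel factor is smooth on the open quadrant**: `y ↦ J₁(4π√(αy₁·βy₂)/c)` is `C^∞` on `(0,∞)²`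
for `α, β > 0` (`J₁` is entire: `contDiff_besselJ_holds`; `√` is smooth off `0`).
[cite: KowalskiMichel2000, §2.4.2 p. 312 — derivation] -/
theorem contDiffOn_besselJ_one_sqrt {α β : ℝ} (hα : 0 < α) (hβ : 0 < β) (c : ℝ) :
    ContDiffOn ℝ ∞ (fun y : ℝ × ℝ ↦ besselJ 1 (4 * π * Real.sqrt (α * y.1 * (β * y.2)) / c))
      (Ioi (0 : ℝ) ×ˢ Ioi (0 : ℝ)) := by
  intro y hy
  have hpos := dilatedProd_pos hα hβ hy
  have hP : ContDiffAt ℝ ∞ (fun y : ℝ × ℝ ↦ α * y.1 * (β * y.2)) y := (contDiff_dilatedProd α β).contDiffAt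
  have hs : ContDiffAt ℝ ∞ (fun y : ℝ × ℝ ↦ Real.sqrt (α * y.1 * (β * y.2))) y := hP.sqrt hpos.ne'
  have harg : ContDiffAt ℝ ∞ (fun y : ℝ × ℝ ↦ 4 * π * Real.sqrt (α * y.1 * (β * y.2)) / c) y :=
    (contDiffAt_const.mul hs).div_const c
  have hJ := ((contDiff_besselJ_holds 1 (m := ∞)).contDiffAt (x := 4 * π * Real.sqrt (α * y.1 * (β * y.2)) / c)).comp
    y harg
  exact hJ.contDiffWithinAt

/-- **The full layer weight is smooth on the open quadrant** (real form):
`g(y) = ((d₁y₁)(d₂y₂))^{−1/2} W((d₁y₁)(d₂y₂)/q̂²) · r⁻¹ · J₁(4π√(αy₁·βy₂)/c)` is `C^∞` on `(0,∞)²`.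
[cite: KowalskiMichelVanderKam2000, (21)–(23) p. 12 and Lemma 3.3 p. 9 — derivation] -/
theorem contDiffOn_layerWeightR {d₁ d₂ Q α β : ℝ} (hd₁ : 0 < d₁) (hd₂ : 0 < d₂) (hQ : 0 < Q)
    (hα : 0 < α) (hβ : 0 < β) (ρ c : ℝ) :
    ContDiffOn ℝ ∞ (fun y : ℝ × ℝ ↦
      (d₁ * y.1 * (d₂ * y.2)) ^ (-(1 / 2 : ℝ)) * cutoffW (d₁ * y.1 * (d₂ * y.2) / Q ^ 2) * ρ *
        besselJ 1 (4 * π * Real.sqrt (α * y.1 * (β * y.2)) / c))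
      (Ioi (0 : ℝ) ×ˢ Ioi (0 : ℝ)) :=
  ((contDiffOn_afeWeightR hd₁ hd₂ hQ).mul contDiffOn_const).mul (contDiffOn_besselJ_one_sqrt hα hβ c)

/-- **The full layer weight, cast to `ℂ`, is smooth on the open quadrant** — the `g` of
`OffDiag.contDiff_dyadicBox_mul`. [cite: KowalskiMichelVanderKam2000, (21)–(23) p. 12 — derivation] -/
theorem contDiffOn_layerWeight {d₁ d₂ Q α β : ℝ} (hd₁ : 0 < d₁) (hd₂ : 0 < d₂) (hQ : 0 < Q)
    (hα : 0 < α) (hβ : 0 < β) (ρ c : ℝ) :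
    ContDiffOn ℝ ∞ (fun y : ℝ × ℝ ↦
      (((d₁ * y.1 * (d₂ * y.2)) ^ (-(1 / 2 : ℝ)) * cutoffW (d₁ * y.1 * (d₂ * y.2) / Q ^ 2) * ρ *
        besselJ 1 (4 * π * Real.sqrt (α * y.1 * (β * y.2)) / c) : ℝ) : ℂ))
      (Ioi (0 : ℝ) ×ˢ Ioi (0 : ℝ)) :=
  Complex.ofRealCLM.contDiff.comp_contDiffOn (contDiffOn_layerWeightR hd₁ hd₂ hQ hα hβ ρ c)

/-! ### The factorisation of the summand at integer points -/

/-- The AFE weight at a dilated integer point is the real weight at that point: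
`w_q(d₁k₁, d₂k₂) = ((d₁k₁)(d₂k₂))^{−1/2} W((d₁k₁)(d₂k₂)/q̂²)`. [cite: KowalskiMichelVanderKam2000, (21) p. 12] -/
theorem afeWeight_dilated (q d₁ d₂ : ℕ) (k : ℕ × ℕ) :
    afeWeight q (d₁ * k.1, d₂ * k.2) =
      ((d₁ : ℝ) * k.1 * ((d₂ : ℝ) * k.2)) ^ (-(1 / 2 : ℝ)) *
        cutoffW ((d₁ : ℝ) * k.1 * ((d₂ : ℝ) * k.2) / qhat q ^ 2) := by
  simp only [afeWeight, Nat.cast_mul]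

/-- **Factorisation of the layer summand**: for `q, r ≥ 1` and natural `α, β, d₁, d₂, k₁, k₂`,
`w_q(d₁k₁,d₂k₂) · petKloostermanTerm q (αk₁) (βk₂) r = g(k₁,k₂) · S(α·k₁, β·k₂; qr)` with
`g(y) = ((d₁y₁)(d₂y₂))^{−1/2} W(·/q̂²) · r⁻¹ · J₁(4π√(αy₁·βy₂)/(qr))` and the Kloosterman arguments in the
product shape `(α : ZMod (qr))·k₁`, `(β : ZMod (qr))·k₂` (the shape of
`OffDiag.sum_sum_kloostermanSum_mul_stdAddChar`). [cite: KowalskiMichel2000, §2.4.2 p. 312 — derivation] -/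
theorem afeWeight_mul_petKloostermanTerm_eq (q : ℕ) [NeZero q] {r : ℕ} (hr : r ≠ 0) [NeZero (q * r)]
    (α β d₁ d₂ : ℕ) (k : ℕ × ℕ) :
    (afeWeight q (d₁ * k.1, d₂ * k.2) : ℂ) * KowalskiMichel2000.petKloostermanTerm q (α * k.1) (β * k.2) r =
      ((((d₁ : ℝ) * k.1 * ((d₂ : ℝ) * k.2)) ^ (-(1 / 2 : ℝ)) *
          cutoffW ((d₁ : ℝ) * k.1 * ((d₂ : ℝ) * k.2) / qhat q ^ 2) * (r : ℝ)⁻¹ *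
          besselJ 1 (4 * π * Real.sqrt ((α : ℝ) * k.1 * ((β : ℝ) * k.2)) / ((q : ℝ) * r)) : ℝ) : ℂ) *
        kloostermanSum (q * r) ((α : ZMod (q * r)) * (k.1 : ZMod (q * r)))
          ((β : ZMod (q * r)) * (k.2 : ZMod (q * r))) := by
  rw [KowalskiMichel2000.petKloostermanTerm_of_ne_zero q _ _ hr, afeWeight_dilated]
  push_cast
  ring

/-- The weight vanishes on the axes: `w_q(d₁k₁, d₂k₂) = 0` if `k₁ = 0` or `k₂ = 0` (Lean's `0^{−1/2} = 0`), so
the layer series over `ℕ × ℕ` is the printed one over `k₁, k₂ ≥ 1` (hypothesis `h0` of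
`OffDiag.tsum_eq_tsum_dyadicBoxes`). [cite: KowalskiMichelVanderKam2000, (21) p. 12] -/
theorem afeWeight_dilated_eq_zero_of_axis (q d₁ d₂ : ℕ) {k : ℕ × ℕ} (hk : k.1 = 0 ∨ k.2 = 0) :
    afeWeight q (d₁ * k.1, d₂ * k.2) = 0 := by
  rw [afeWeight_dilated]
  have h0 : (d₁ : ℝ) * k.1 * ((d₂ : ℝ) * k.2) = 0 := by
    rcases hk with h | h <;> simp [h]
  rw [h0, Real.zero_rpow (by norm_num), zero_mul]

end Summit.Parity.GeneralizedHardyLittlewood.Theorems.BeyondDiagonalBeatsQuarter.OffDiag
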